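import Mathlib
import Literature.Analysis.Calculus.IntervalCauchySchwarz
import Literature.Analysis.Calculus.EnergyTailCutoff

/-!
# Peeling, file 1a: small `L²` tools on a half-line

Support file for `stub_peel` of the line `crum-peeling-recessive-tower` (crux
`UniformPhotonSphereChannelsR`, stmt-FinalStateConjecture-14074).  Everything here is
one-dimensional real analysis on a half-line `(X, ∞)`:

* `setIntegral_abs_mul_le` — Cauchy–Schwarz `∫_s |f g| ≤ √(∫_s f²) √(∫_s g²)` from square
  integrability only;
* `sq_le_of_sq_deriv_integrableOn`, `tendsto_sq_div_self` — a function with square-integrable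
  derivative on `(X, ∞)` grows at most like `√x`, indeed `f(Y)²/Y → 0`;
* `exists_abs_deriv_lt_of_tendsto_zero` — a differentiable function tending to `0` has arbitrarily
  small derivative at arbitrarily large points (mean value theorem);
* glue and conversion lemmas between `IntegrableOn` and finite lower Lebesgue integrals.

The two Hardy inequalities of the peeling are in the companion file `…RPeelHardyTail`.
-/

noncomputable section

-- the doubled `FinalStateConjecture` component is the tree's fixed summit/problem path
set_option linter.dupNamespace false

namespace Summit.FinalStateConjecture.FinalStateConjecture.Theorems.CrumPeelingRecessiveTower

open MeasureTheory Set Filter Topology intervalIntegral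

/-! ### Cauchy–Schwarz from square integrability -/

/-- The product of two square-integrable functions on a set is integrable there. -/
theorem integrableOn_mul_of_sq {s : Set ℝ} {f g : ℝ → ℝ}
    (hfm : AEStronglyMeasurable f (volume.restrict s))
    (hgm : AEStronglyMeasurable g (volume.restrict s))
    (hf2 : IntegrableOn (fun x => f x ^ 2) s) (hg2 : IntegrableOn (fun x => g x ^ 2) s) :
    IntegrableOn (fun x => f x * g x) s := by
  refine Integrable.mono' ((hf2.add hg2).div_const 2) (hfm.mul hgm) (ae_of_all _ fun x => ?_)
  rw [Real.norm_eq_abs, abs_mul]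
  show |f x| * |g x| ≤ (f x ^ 2 + g x ^ 2) / 2
  nlinarith [sq_nonneg (|f x| - |g x|), sq_abs (f x), sq_abs (g x)]

/-- **Cauchy–Schwarz** on a set, from square integrability:
`∫_s |f g| ≤ √(∫_s f²) · √(∫_s g²)`. -/
theorem setIntegral_abs_mul_le {s : Set ℝ} {f g : ℝ → ℝ}
    (hfm : AEStronglyMeasurable f (volume.restrict s))
    (hgm : AEStronglyMeasurable g (volume.restrict s))
    (hf2 : IntegrableOn (fun x => f x ^ 2) s) (hg2 : IntegrableOn (fun x => g x ^ 2) s) :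
    ∫ x in s, |f x * g x| ≤ Real.sqrt (∫ x in s, f x ^ 2) * Real.sqrt (∫ x in s, g x ^ 2) := by
  have hA : 0 ≤ ∫ x in s, f x ^ 2 := integral_nonneg fun x => sq_nonneg _
  have hB : 0 ≤ ∫ x in s, g x ^ 2 := integral_nonneg fun x => sq_nonneg _
  have hfg : IntegrableOn (fun x => |f x * g x|) s := (integrableOn_mul_of_sq hfm hgm hf2 hg2).abs
  refine Literature.Analysis.Calculus.le_sqrt_mul_sqrt_of_forall_pos hA hB fun lam hlam => ?_
  have hpt : ∀ x, 2 * |f x * g x| ≤ lam * f x ^ 2 + lam⁻¹ * g x ^ 2 := by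
    intro x
    have hsq : 0 ≤ (Real.sqrt lam * |f x| - |g x| / Real.sqrt lam) ^ 2 := sq_nonneg _
    have hsl : Real.sqrt lam ^ 2 = lam := Real.sq_sqrt hlam.le
    have hsl0 : Real.sqrt lam ≠ 0 := (Real.sqrt_pos.2 hlam).ne'
    have hp2 : (Real.sqrt lam * |f x|) ^ 2 = lam * f x ^ 2 := by rw [mul_pow, hsl, sq_abs]
    have hq2 : (|g x| / Real.sqrt lam) ^ 2 = lam⁻¹ * g x ^ 2 := by
      rw [div_pow, hsl, sq_abs]; ring
    have hpq : (Real.sqrt lam * |f x|) * (|g x| / Real.sqrt lam) = |f x| * |g x| := by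
      field_simp
    rw [sub_sq, hp2, hq2, mul_assoc, hpq] at hsq
    rw [abs_mul]
    linarith
  have hint : ∫ x in s, 2 * |f x * g x| ≤ ∫ x in s, (lam * f x ^ 2 + lam⁻¹ * g x ^ 2) :=
    integral_mono (hfg.const_mul 2) ((hf2.const_mul lam).add (hg2.const_mul lam⁻¹))
      fun x => hpt x
  rw [MeasureTheory.integral_const_mul, integral_add (hf2.const_mul lam) (hg2.const_mul lam⁻¹),
    MeasureTheory.integral_const_mul, MeasureTheory.integral_const_mul] at hint
  rw [div_eq_inv_mul]
  linarith

/-- Squared form of Cauchy–Schwarz: `(∫_s |f g|)² ≤ (∫_s f²) (∫_s g²)`. -/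
theorem sq_setIntegral_abs_mul_le {s : Set ℝ} {f g : ℝ → ℝ}
    (hfm : AEStronglyMeasurable f (volume.restrict s))
    (hgm : AEStronglyMeasurable g (volume.restrict s))
    (hf2 : IntegrableOn (fun x => f x ^ 2) s) (hg2 : IntegrableOn (fun x => g x ^ 2) s) :
    (∫ x in s, |f x * g x|) ^ 2 ≤ (∫ x in s, f x ^ 2) * (∫ x in s, g x ^ 2) := by
  have hA : 0 ≤ ∫ x in s, f x ^ 2 := integral_nonneg fun x => sq_nonneg _
  have hB : 0 ≤ ∫ x in s, g x ^ 2 := integral_nonneg fun x => sq_nonneg _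
  have h0 : 0 ≤ ∫ x in s, |f x * g x| := integral_nonneg fun x => abs_nonneg _
  have h := setIntegral_abs_mul_le hfm hgm hf2 hg2
  calc (∫ x in s, |f x * g x|) ^ 2
      ≤ (Real.sqrt (∫ x in s, f x ^ 2) * Real.sqrt (∫ x in s, g x ^ 2)) ^ 2 :=
        pow_le_pow_left₀ h0 h 2
    _ = (∫ x in s, f x ^ 2) * (∫ x in s, g x ^ 2) := by
        rw [mul_pow, Real.sq_sqrt hA, Real.sq_sqrt hB]

/-! ### Growth of a function with square-integrable derivative -/

/-- If `f' ∈ L²(X, ∞)` is the (continuous) derivative of `f` on `[X, ∞)`, then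
`f(Y)² ≤ 2 f(X)² + 2 (Y − X) ∫_{(X,∞)} f'²` for `Y ≥ X`. -/
theorem sq_le_of_sq_deriv_integrableOn {f f' : ℝ → ℝ} {X : ℝ}
    (hf : ∀ x, X ≤ x → HasDerivAt f (f' x) x) (hf'c : ContinuousOn f' (Ici X))
    (hf'2 : IntegrableOn (fun x => f' x ^ 2) (Ioi X)) {Y : ℝ} (hY : X ≤ Y) :
    f Y ^ 2 ≤ 2 * f X ^ 2 + 2 * (Y - X) * ∫ x in Ioi X, f' x ^ 2 := by
  have hcI : ContinuousOn f' (Icc X Y) := hf'c.mono Icc_subset_Ici_self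
  have hftc : ∫ x in X..Y, f' x = f Y - f X :=
    integral_eq_sub_of_hasDerivAt (fun x hx => hf x (by rw [uIcc_of_le hY] at hx; exact hx.1))
      (hcI.intervalIntegrable_of_Icc hY)
  -- Cauchy–Schwarz on `Ioc X Y` against the constant `1`
  have hm : AEStronglyMeasurable f' (volume.restrict (Ioc X Y)) :=
    (hcI.mono Ioc_subset_Icc_self).aestronglyMeasurable measurableSet_Ioc
  have h1m : AEStronglyMeasurable (fun _ : ℝ => (1 : ℝ)) (volume.restrict (Ioc X Y)) :=
    aestronglyMeasurable_const
  have hf2' : IntegrableOn (fun x => f' x ^ 2) (Ioc X Y) := hf'2.mono_set Ioc_subset_Ioi_self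
  have h12 : IntegrableOn (fun _ : ℝ => (1 : ℝ) ^ 2) (Ioc X Y) := by
    simp only [one_pow]; exact integrableOn_const (by simp)
  have hcs := sq_setIntegral_abs_mul_le hm h1m hf2' h12
  simp only [mul_one, one_pow] at hcs
  rw [setIntegral_const, smul_eq_mul, mul_one, Real.volume_real_Ioc_of_le hY] at hcs
  have habs : |f Y - f X| ≤ ∫ x in Ioc X Y, |f' x| := by
    rw [← hftc, integral_of_le hY]
    exact abs_integral_le_integral_abs
  have hmono : ∫ x in Ioc X Y, f' x ^ 2 ≤ ∫ x in Ioi X, f' x ^ 2 :=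
    setIntegral_mono_set hf'2 (ae_of_all _ fun x => sq_nonneg _)
      (ae_of_all _ Ioc_subset_Ioi_self)
  have h0 : 0 ≤ ∫ x in Ioc X Y, |f' x| := integral_nonneg fun x => abs_nonneg _
  have hsq : (f Y - f X) ^ 2 ≤ (Y - X) * ∫ x in Ioi X, f' x ^ 2 := by
    calc (f Y - f X) ^ 2 = |f Y - f X| ^ 2 := (sq_abs _).symm
      _ ≤ (∫ x in Ioc X Y, |f' x|) ^ 2 := pow_le_pow_left₀ (abs_nonneg _) habs 2
      _ ≤ (∫ x in Ioc X Y, f' x ^ 2) * (Y - X) := hcs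
      _ ≤ (∫ x in Ioi X, f' x ^ 2) * (Y - X) := mul_le_mul_of_nonneg_right hmono (by linarith)
      _ = (Y - X) * ∫ x in Ioi X, f' x ^ 2 := by ring
  nlinarith [hsq, sq_nonneg (f Y - 2 * f X)]

/-- If `f' ∈ L²(X, ∞)` is the continuous derivative of `f` on `[X, ∞)`, then `f(Y)²/Y → 0` as
`Y → +∞` (so `f = o(√Y)`). -/
theorem tendsto_sq_div_self {f f' : ℝ → ℝ} {X : ℝ}
    (hf : ∀ x, X ≤ x → HasDerivAt f (f' x) x) (hf'c : ContinuousOn f' (Ici X))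
    (hf'2 : IntegrableOn (fun x => f' x ^ 2) (Ioi X)) :
    Tendsto (fun Y => f Y ^ 2 / Y) atTop (𝓝 0) := by
  rw [Metric.tendsto_atTop]
  intro ε hε
  -- a base point `X'` beyond which the tail of `∫ f'²` is below `ε/4`
  have htail := Literature.Analysis.Calculus.tendsto_setIntegral_Ioi_tail hf'2
  obtain ⟨X₁, hX₁⟩ := (Metric.tendsto_atTop.1 htail) (ε / 4) (by positivity)
  set X' : ℝ := max (max X X₁) 1 with hX'
  have hXX' : X ≤ X' := le_trans (le_max_left _ _) (le_max_left _ _)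
  have hX'1 : 1 ≤ X' := le_max_right _ _
  have htail' : ∫ x in Ioi X', f' x ^ 2 < ε / 4 := by
    have h := hX₁ X' (le_trans (le_max_right _ _) (le_max_left _ _))
    rw [Real.dist_eq, sub_zero, abs_of_nonneg (integral_nonneg fun x => sq_nonneg _)] at h
    exact h
  have hbase : ∀ Y, X' ≤ Y → f Y ^ 2 ≤ 2 * f X' ^ 2 + 2 * (Y - X') * ∫ x in Ioi X', f' x ^ 2 :=
    fun Y hY => sq_le_of_sq_deriv_integrableOn (fun x hx => hf x (hXX'.trans hx))
      (hf'c.mono (Ici_subset_Ici.2 hXX')) (hf'2.mono_set (Ioi_subset_Ioi hXX')) hY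
  refine ⟨max X' (4 * f X' ^ 2 / ε + 1), fun Y hY => ?_⟩
  have hYX' : X' ≤ Y := le_trans (le_max_left _ _) hY
  have hY0 : 0 < Y := by linarith
  have hY2 : 4 * f X' ^ 2 / ε < Y := by linarith [le_max_right X' (4 * f X' ^ 2 / ε + 1)]
  rw [Real.dist_eq, sub_zero, abs_of_nonneg (div_nonneg (sq_nonneg _) hY0.le), div_lt_iff₀ hY0]
  have h1 : 2 * f X' ^ 2 < ε / 2 * Y := by
    rw [div_lt_iff₀ hε] at hY2
    linarith
  have h2 : 2 * (Y - X') * ∫ x in Ioi X', f' x ^ 2 ≤ ε / 2 * Y := by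
    have h0 : 0 ≤ ∫ x in Ioi X', f' x ^ 2 := integral_nonneg fun x => sq_nonneg _
    nlinarith
  linarith [hbase Y hYX']

/-! ### Small derivatives of functions tending to zero -/

/-- If `g → 0` at `+∞` and `g` is differentiable on `(X, ∞)` with derivative `g'`, then `g'` takes
arbitrarily small values at arbitrarily large points (mean value theorem on `[x, x+1]`). -/
theorem exists_abs_deriv_lt_of_tendsto_zero {g g' : ℝ → ℝ} {X : ℝ}
    (hg : ∀ x, X < x → HasDerivAt g (g' x) x) (hlim : Tendsto g atTop (𝓝 0))
    {ε : ℝ} (hε : 0 < ε) (X' : ℝ) : ∃ x, X' ≤ x ∧ |g' x| < ε := by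
  have hdiff : Tendsto (fun x => g (x + 1) - g x) atTop (𝓝 0) := by
    have h1 : Tendsto (fun x => g (x + 1)) atTop (𝓝 0) :=
      hlim.comp (tendsto_atTop_add_const_right atTop 1 tendsto_id)
    simpa using h1.sub hlim
  obtain ⟨x₀, hx₀⟩ := (Metric.tendsto_atTop.1 hdiff) ε hε
  set x₁ : ℝ := max (max x₀ X') (X + 1) with hx₁
  have hx₁X : X < x₁ := by
    have : X + 1 ≤ x₁ := le_max_right _ _
    linarith
  have hcont : ContinuousOn g (Icc x₁ (x₁ + 1)) := fun x hx =>
    (hg x (hx₁X.trans_le hx.1)).continuousAt.continuousWithinAt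
  obtain ⟨c, hc, hcd⟩ := exists_hasDerivAt_eq_slope g g' (by linarith) hcont
    (fun x hx => hg x (hx₁X.trans hx.1))
  refine ⟨c, ?_, ?_⟩
  · have : X' ≤ x₁ := le_trans (le_max_right _ _) (le_max_left _ _)
    exact this.trans hc.1.le
  · have h := hx₀ x₁ (le_trans (le_max_left _ _) (le_max_left _ _))
    rw [Real.dist_eq, sub_zero] at h
    rw [hcd, add_sub_cancel_left, div_one]
    exact h

/-! ### Glue and conversion lemmas -/

/-- Integrability on `(c, ∞)` from continuity on `[c, X]` and integrability on `(X, ∞)`. -/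
theorem integrableOn_Ioi_of_continuousOn_Icc {h : ℝ → ℝ} {c X : ℝ}
    (hcont : ContinuousOn h (Icc c X)) (hint : IntegrableOn h (Ioi X)) :
    IntegrableOn h (Ioi c) := by
  have h1 : IntegrableOn h (Icc c X) := hcont.integrableOn_compact isCompact_Icc
  have h2 : IntegrableOn h (Icc c X ∪ Ioi X) := h1.union hint
  exact h2.mono_set fun x hx => by
    rcases le_or_gt x X with hxX | hxX
    · exact Or.inl ⟨le_of_lt hx, hxX⟩
    · exact Or.inr hxX

/-- From a finite lower Lebesgue integral of an a.e.-measurable, nonnegative function on a set to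
Bochner integrability, with the conversion identity. -/
theorem integrableOn_of_lintegral_ne_top {h : ℝ → ℝ} {s : Set ℝ}
    (hm : AEStronglyMeasurable h (volume.restrict s)) (h0 : ∀ x ∈ s, 0 ≤ h x)
    (hs : MeasurableSet s) (hfin : ∫⁻ x in s, ENNReal.ofReal (h x) ≠ ⊤) :
    IntegrableOn h s ∧ ENNReal.ofReal (∫ x in s, h x) = ∫⁻ x in s, ENNReal.ofReal (h x) := by
  have hae : 0 ≤ᵐ[volume.restrict s] h := by
    filter_upwards [ae_restrict_mem hs] with x hx using h0 x hx
  have hint : IntegrableOn h s :=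
    ⟨hm, (hasFiniteIntegral_iff_ofReal hae).2 (lt_top_iff_ne_top.2 hfin)⟩
  exact ⟨hint, ofReal_integral_eq_lintegral_ofReal hint hae⟩

/-- The lower Lebesgue integral of an integrable nonnegative function on a set is `ofReal` of its
Bochner integral (and in particular finite). -/
theorem lintegral_eq_ofReal_of_integrableOn {h : ℝ → ℝ} {s : Set ℝ} (hs : MeasurableSet s)
    (hint : IntegrableOn h s) (h0 : ∀ x ∈ s, 0 ≤ h x) :
    ∫⁻ x in s, ENNReal.ofReal (h x) = ENNReal.ofReal (∫ x in s, h x) := by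
  have hae : 0 ≤ᵐ[volume.restrict s] h := by
    filter_upwards [ae_restrict_mem hs] with x hx using h0 x hx
  exact (ofReal_integral_eq_lintegral_ofReal hint hae).symm

/-- Registered sub-goal `peel_sqrtGrowth` of `stub_peel` (verbatim signature): a function whose
derivative is square integrable on `(X, ∞)` satisfies `f(Y)²/Y → 0`. -/
theorem peel_sqrtGrowth : ∀ (f f' : ℝ → ℝ) (X : ℝ), (∀ x, X ≤ x → HasDerivAt f (f' x) x) →
    ContinuousOn f' (Set.Ici X) → MeasureTheory.IntegrableOn (fun x => f' x ^ 2) (Set.Ioi X) →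
    Filter.Tendsto (fun Y => f Y ^ 2 / Y) Filter.atTop (nhds 0) :=
  fun _ _ _ hf hf'c hf'2 => tendsto_sq_div_self hf hf'c hf'2

end Summit.FinalStateConjecture.FinalStateConjecture.Theorems.CrumPeelingRecessiveTower
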